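import Mathlib
import HarnessLib
import Summits.Ventures.LatticeQCDFlow.Scoring.TwoCodeAgreementInProbability
import Summits.Ventures.LatticeQCDFlow.Scoring.AsymptoticCoverage
import Summits.Ventures.LatticeQCDFlow.Scoring.AgreementTestPower

/-!
# "Acceptance A vs B within 3 pp" as an EQUIVALENCE test: the confidence-adjusted tolerance rule
# `|Sₙ^A − S_{mₙ}^B| + z·√(V̂ₙ^A + V̂_{mₙ}^B) ≤ ε` passes with probability `→ 1` when the targets
# differ by less than `ε`, `→ 0` when by more, and — at the boundary `a_A − a_B = ε` — with
# limiting probability at most `N(0,1)((−∞, −z])`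

HONEST FRAMING: exact (Metropolis-corrected) sampling algorithms for lattice gauge theory;
figures of merit are autocorrelation/cost numbers at stated couplings and volumes; no
continuum-physics claim.

Venture `LatticeQCDFlow` (cell pub-lqcd), topic `Scoring`; FANOUT row 4 (`s0-u1-b`, rung S0-B:
"acceptance A vs B within 3 pp at every β").  The acceptance column's criterion is a fixed
TOLERANCE `ε` (3 pp), not a multiple of the combined error bar.  Read on point estimates alone,
`|Sₙ^A − S_{mₙ}^B| ≤ ε` is asymptotically a coin flip when the two targets differ by exactly `ε`
and says nothing about the confidence with which the tolerance is met.  The textbook repair is the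
equivalence ("two one-sided") test: declare agreement when the tolerance is met WITH a margin of
`z` combined standard errors, `|Sₙ^A − S_{mₙ}^B| + z √(V̂ₙ^A + V̂_{mₙ}^B) ≤ ε`.  In the abstract
two-code setting of the packet (independent codes, `√n (Sₙ^X − a_X) ⇒ N(0, s_X)`, `n·V̂ₙ^X → s_X` in
probability, code `B` read along `mₙ → ∞`) this file proves its three operating characteristics:
(i) INSIDE the tolerance, `|a_A − a_B| < ε`: pass probability `→ 1`, for every margin `z`
(**`twoSample_tolerance_inside`**); (ii) OUTSIDE, `|a_A − a_B| > ε`: pass probability `→ 0`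
(**`twoSample_tolerance_outside`**) — both from the consistency of the columns and `V̂ → 0`, no
positivity of the variances needed; (iii) AT THE BOUNDARY `a_A − a_B = ε` (`s_A, s_B > 0`): for
every `η > 0`, eventually the pass probability is `< N(0,1)((−∞, −z]) + η`
(**`twoSample_tolerance_boundary`**: recentring code `B` by `ε` puts the two codes under the null of
`twoSample_agreement_clt_of_tendstoInMeasure`, so `(Dₙ − ε)/σ̂ₙ ⇒ N(0,1)`, and the pass event forces
`(Dₙ − ε)/σ̂ₙ ≤ −z` unless the error bar degenerates, an event of vanishing probability).  So the
margin `z` is the one-sided Gaussian level of wrongly certifying a boundary discrepancy as "within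
tolerance" (`z = 2`: at most `φ(2)/2 < 0.0271` by the Mills bound of
`Scoring/SimultaneousAgreementTwoSigma`), while the bare rule `z = 0` certifies it half the time.
NEW WORK of the cell (textbook; our formalisation); no definition; nothing cited as a fact.
Printed counterparts NAMED ONLY: Schuirmann's two one-sided tests (1987) / bioequivalence testing.

## Content

* `tendsto_measureReal_le_one_of_tendstoInMeasure_lt` (`Xₙ → c < ε` in probability, `Xₙ`
  measurable ⇒ `P(Xₙ ≤ ε) → 1`), `tendsto_measureReal_le_zero_of_tendstoInMeasure_gt` (`c > ε` ⇒
  `P(Xₙ ≤ ε) → 0`);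
* `tendstoInMeasure_toleranceStatistic` — `|Dₙ| + z √(V̂ₙ^A + V̂_{mₙ}^B) → |a_A − a_B|` in
  probability on `P_A ⊗ P_B`;
* **`twoSample_tolerance_inside`**, **`twoSample_tolerance_outside`**,
  **`twoSample_tolerance_boundary`**.

NOT CLAIMED: the boundary case `a_A − a_B = −ε` separately (apply (iii) to the negated columns);
the exact boundary limit (`= N(0,1)((−∞, −z])` for `z > 0`; only the upper bound is proved);
finite-sample versions (`Scoring/TwoCodeUnionBound`); dependent codes; any number of ours.
-/

noncomputable section

namespace Summit.Ventures.LatticeQCDFlow.Scoring.CardConsistency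

open MeasureTheory ProbabilityTheory Filter Set
open scoped Topology ENNReal NNReal

/-! ## §1 Two elementary consequences of convergence in probability -/

section InMeasure

variable {Ω : Type*} [MeasurableSpace Ω] {P : Measure Ω} [IsProbabilityMeasure P]

/-- `Xₙ → c` in probability, `c < ε`, `Xₙ` measurable ⇒ `P(Xₙ ≤ ε) → 1`. [folklore] -/
theorem tendsto_measureReal_le_one_of_tendstoInMeasure_lt {X : ℕ → Ω → ℝ} {c ε : ℝ}
    (hX : ∀ n, Measurable (X n)) (h : TendstoInMeasure P X atTop fun _ => c) (hc : c < ε) :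
    Tendsto (fun n => P.real {ω | X n ω ≤ ε}) atTop (𝓝 1) := by
  rw [tendstoInMeasure_iff_norm] at h
  have hδ := (ENNReal.tendsto_toReal ENNReal.zero_ne_top).comp (h (ε - c) (by linarith))
  rw [ENNReal.toReal_zero] at hδ
  have hlow : Tendsto (fun n => 1 - (P {ω | ε - c ≤ ‖X n ω - c‖}).toReal) atTop (𝓝 1) := by
    have := hδ.const_sub 1
    simpa using this
  refine tendsto_of_tendsto_of_tendsto_of_le_of_le' hlow tendsto_const_nhds
    (Eventually.of_forall fun n => ?_) (Eventually.of_forall fun n => measureReal_le_one)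
  have hcompl : P.real {ω | X n ω ≤ ε}ᶜ = 1 - P.real {ω | X n ω ≤ ε} :=
    probReal_compl_eq_one_sub (measurableSet_le (hX n) measurable_const)
  have hsub : {ω | X n ω ≤ ε}ᶜ ⊆ {ω | ε - c ≤ ‖X n ω - c‖} := by
    intro ω hω
    simp only [mem_compl_iff, mem_setOf_eq, not_le] at hω ⊢
    rw [Real.norm_eq_abs]
    exact le_trans (by linarith) (le_abs_self _)
  have h1 : P.real {ω | X n ω ≤ ε}ᶜ ≤ (P {ω | ε - c ≤ ‖X n ω - c‖}).toReal :=
    measureReal_mono hsub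
  show 1 - (P {ω | ε - c ≤ ‖X n ω - c‖}).toReal ≤ P.real {ω | X n ω ≤ ε}
  linarith

omit [IsProbabilityMeasure P] in
/-- `Xₙ → c` in probability, `ε < c` ⇒ `P(Xₙ ≤ ε) → 0` (finite measure). [folklore] -/
theorem tendsto_measureReal_le_zero_of_tendstoInMeasure_gt [IsFiniteMeasure P] {X : ℕ → Ω → ℝ}
    {c ε : ℝ} (h : TendstoInMeasure P X atTop fun _ => c) (hc : ε < c) :
    Tendsto (fun n => P.real {ω | X n ω ≤ ε}) atTop (𝓝 0) := by
  rw [tendstoInMeasure_iff_norm] at h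
  have hδ := (ENNReal.tendsto_toReal ENNReal.zero_ne_top).comp (h (c - ε) (by linarith))
  rw [ENNReal.toReal_zero] at hδ
  refine tendsto_of_tendsto_of_tendsto_of_le_of_le' tendsto_const_nhds hδ
    (Eventually.of_forall fun n => measureReal_nonneg) (Eventually.of_forall fun n => ?_)
  refine measureReal_mono fun ω hω => ?_
  simp only [mem_setOf_eq] at hω ⊢
  rw [Real.norm_eq_abs]
  calc c - ε ≤ -(X n ω - c) := by linarith
    _ ≤ |X n ω - c| := neg_le_abs _

end InMeasure

/-! ## §2 The tolerance statistic and the three operating characteristics -/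

section Tolerance

variable {ΩA : Type*} [MeasurableSpace ΩA] {PA : Measure ΩA} [IsProbabilityMeasure PA]
variable {ΩB : Type*} [MeasurableSpace ΩB] {PB : Measure ΩB} [IsProbabilityMeasure PB]
variable {Ω' : Type*} [MeasurableSpace Ω'] {P' : Measure Ω'} [IsProbabilityMeasure P']

/-- **The tolerance statistic is consistent**: `|Sₙ^A − S_{mₙ}^B| + z √(V̂ₙ^A + V̂_{mₙ}^B) →
|a_A − a_B|` in probability on `P_A ⊗ P_B` (one-code CLTs pin the centrings; `n·V̂ₙ^X → s_X` in
probability makes the error bars vanish). [ours] -/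
theorem tendstoInMeasure_toleranceStatistic {SA VA : ℕ → ΩA → ℝ} {SB VB : ℕ → ΩB → ℝ}
    {aA aB sA sB : ℝ} {ZA ZB : Ω' → ℝ}
    (hcltA : TendstoInDistribution (fun (n : ℕ) ω => Real.sqrt n * (SA n ω - aA)) atTop ZA
      (fun _ => PA) P')
    (hcltB : TendstoInDistribution (fun (n : ℕ) ω => Real.sqrt n * (SB n ω - aB)) atTop ZB
      (fun _ => PB) P')
    (hVA : TendstoInMeasure PA (fun (n : ℕ) ω => (n : ℝ) * VA n ω) atTop fun _ => sA)
    (hVB : TendstoInMeasure PB (fun (n : ℕ) ω => (n : ℝ) * VB n ω) atTop fun _ => sB)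
    {m : ℕ → ℕ} (hm : Tendsto m atTop atTop) (z : ℝ) :
    TendstoInMeasure (PA.prod PB) (fun (n : ℕ) (ω : ΩA × ΩB) =>
        |SA n ω.1 - SB (m n) ω.2| + z * Real.sqrt (VA n ω.1 + VB (m n) ω.2)) atTop
      fun _ => |aA - aB| := by
  have hSA : TendstoInMeasure PA SA atTop fun _ => aA :=
    tendstoInMeasure_of_tendstoInDistribution_scaled
      (Real.tendsto_sqrt_atTop.comp tendsto_natCast_atTop_atTop) hcltA
  have hSB : TendstoInMeasure PB SB atTop fun _ => aB :=
    tendstoInMeasure_of_tendstoInDistribution_scaled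
      (Real.tendsto_sqrt_atTop.comp tendsto_natCast_atTop_atTop) hcltB
  have hSA' := tendstoInMeasure_comp_fst (PB := PB) hSA
  have hSB' := tendstoInMeasure_comp_snd (PA := PA) (tendstoInMeasure_comp_tendsto hSB hm)
  have hEA := tendstoInMeasure_comp_fst (PB := PB) (tendstoInMeasure_errorBar_zero hVA)
  have hEB := tendstoInMeasure_comp_snd (PA := PA)
    (tendstoInMeasure_comp_tendsto (tendstoInMeasure_errorBar_zero hVB) hm)
  -- `|Dₙ| → |Δ|`
  have hsub : ContinuousAt (fun p : ℝ × ℝ => |p.1 - p.2|) (aA, aB) := by fun_prop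
  have hD := tendstoInMeasure_comp_continuousAt_normed (tendstoInMeasure_prodMk hSA' hSB') hsub
  -- `z √(V̂^A + V̂^B) → 0`
  have hadd : ContinuousAt (fun p : ℝ × ℝ => z * Real.sqrt (p.1 + p.2)) ((0 : ℝ), (0 : ℝ)) := by
    fun_prop
  have hE := tendstoInMeasure_comp_continuousAt_normed (tendstoInMeasure_prodMk hEA hEB) hadd
  simp only [add_zero, Real.sqrt_zero, mul_zero] at hE
  -- sum
  have hplus : ContinuousAt (fun p : ℝ × ℝ => p.1 + p.2) (|aA - aB|, (0 : ℝ)) := by fun_prop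
  have h := tendstoInMeasure_comp_continuousAt_normed (tendstoInMeasure_prodMk hD hE) hplus
  simp only [add_zero] at h
  refine h.congr' ?_ EventuallyEq.rfl
  filter_upwards [eventually_ge_atTop 1, hm.eventually (eventually_ge_atTop 1)] with n hn1 hm1
  refine Eventually.of_forall fun ω => ?_
  have hn0 : (n : ℝ) ≠ 0 := Nat.cast_ne_zero.2 (by omega)
  have hm0 : ((m n : ℕ) : ℝ) ≠ 0 := Nat.cast_ne_zero.2 (by omega)
  show |SA n ω.1 - SB (m n) ω.2| + z * Real.sqrt ((n : ℝ) * VA n ω.1 * (n : ℝ)⁻¹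
      + ((m n : ℕ) : ℝ) * VB (m n) ω.2 * ((m n : ℕ) : ℝ)⁻¹)
    = |SA n ω.1 - SB (m n) ω.2| + z * Real.sqrt (VA n ω.1 + VB (m n) ω.2)
  have e1 : (n : ℝ) * VA n ω.1 * (n : ℝ)⁻¹ = VA n ω.1 := by field_simp
  have e2 : ((m n : ℕ) : ℝ) * VB (m n) ω.2 * ((m n : ℕ) : ℝ)⁻¹ = VB (m n) ω.2 := by field_simp
  rw [e1, e2]

/-- **INSIDE THE TOLERANCE the rule passes with probability `→ 1`**: `|a_A − a_B| < ε` ⇒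
`(P_A ⊗ P_B)(|Sₙ^A − S_{mₙ}^B| + z √(V̂ₙ^A + V̂_{mₙ}^B) ≤ ε) → 1`, for every margin `z`. [ours] -/
theorem twoSample_tolerance_inside {SA VA : ℕ → ΩA → ℝ} {SB VB : ℕ → ΩB → ℝ}
    {aA aB sA sB ε : ℝ} {ZA ZB : Ω' → ℝ} (hin : |aA - aB| < ε)
    (hSAm : ∀ n, Measurable (SA n)) (hVAm : ∀ n, Measurable (VA n))
    (hSBm : ∀ n, Measurable (SB n)) (hVBm : ∀ n, Measurable (VB n))
    (hcltA : TendstoInDistribution (fun (n : ℕ) ω => Real.sqrt n * (SA n ω - aA)) atTop ZA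
      (fun _ => PA) P')
    (hcltB : TendstoInDistribution (fun (n : ℕ) ω => Real.sqrt n * (SB n ω - aB)) atTop ZB
      (fun _ => PB) P')
    (hVA : TendstoInMeasure PA (fun (n : ℕ) ω => (n : ℝ) * VA n ω) atTop fun _ => sA)
    (hVB : TendstoInMeasure PB (fun (n : ℕ) ω => (n : ℝ) * VB n ω) atTop fun _ => sB)
    {m : ℕ → ℕ} (hm : Tendsto m atTop atTop) (z : ℝ) :
    Tendsto (fun n => (PA.prod PB).real {ω : ΩA × ΩB |
        |SA n ω.1 - SB (m n) ω.2| + z * Real.sqrt (VA n ω.1 + VB (m n) ω.2) ≤ ε}) atTop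
      (𝓝 1) :=
  tendsto_measureReal_le_one_of_tendstoInMeasure_lt
    (fun n => (((hSAm n).comp measurable_fst).sub ((hSBm (m n)).comp measurable_snd)).abs.add
      ((((hVAm n).comp measurable_fst).add ((hVBm (m n)).comp measurable_snd)).sqrt.const_mul z))
    (tendstoInMeasure_toleranceStatistic hcltA hcltB hVA hVB hm z) hin

/-- **OUTSIDE THE TOLERANCE the rule passes with probability `→ 0`**: `ε < |a_A − a_B|` ⇒
`(P_A ⊗ P_B)(|Sₙ^A − S_{mₙ}^B| + z √(V̂ₙ^A + V̂_{mₙ}^B) ≤ ε) → 0`, for every margin `z`. [ours] -/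
theorem twoSample_tolerance_outside {SA VA : ℕ → ΩA → ℝ} {SB VB : ℕ → ΩB → ℝ}
    {aA aB sA sB ε : ℝ} {ZA ZB : Ω' → ℝ} (hout : ε < |aA - aB|)
    (hcltA : TendstoInDistribution (fun (n : ℕ) ω => Real.sqrt n * (SA n ω - aA)) atTop ZA
      (fun _ => PA) P')
    (hcltB : TendstoInDistribution (fun (n : ℕ) ω => Real.sqrt n * (SB n ω - aB)) atTop ZB
      (fun _ => PB) P')
    (hVA : TendstoInMeasure PA (fun (n : ℕ) ω => (n : ℝ) * VA n ω) atTop fun _ => sA)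
    (hVB : TendstoInMeasure PB (fun (n : ℕ) ω => (n : ℝ) * VB n ω) atTop fun _ => sB)
    {m : ℕ → ℕ} (hm : Tendsto m atTop atTop) (z : ℝ) :
    Tendsto (fun n => (PA.prod PB).real {ω : ΩA × ΩB |
        |SA n ω.1 - SB (m n) ω.2| + z * Real.sqrt (VA n ω.1 + VB (m n) ω.2) ≤ ε}) atTop
      (𝓝 0) :=
  tendsto_measureReal_le_zero_of_tendstoInMeasure_gt
    (tendstoInMeasure_toleranceStatistic hcltA hcltB hVA hVB hm z) hout

/-- **AT THE BOUNDARY the margin `z` is the one-sided Gaussian level.**  Two independent codes as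
in `twoSample_agreement_clt_of_tendstoInMeasure` (measurable columns and error bars, `V̂ₙ^B ≥ 0`,
one-code CLTs with `s_A, s_B > 0`, `n·V̂ₙ^X → s_X` in probability, `mₙ → ∞`) whose targets differ
by EXACTLY the tolerance, `a_A − a_B = ε`.  Then for every margin `z` and every `η > 0`, eventually
`(P_A ⊗ P_B)(|Sₙ^A − S_{mₙ}^B| + z √(V̂ₙ^A + V̂_{mₙ}^B) ≤ ε) < N(0,1)((−∞, −z]) + η`. [ours] -/
theorem twoSample_tolerance_boundary {SA VA : ℕ → ΩA → ℝ} {SB VB : ℕ → ΩB → ℝ}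
    {aA aB sA sB ε : ℝ} {ZA ZB Z : Ω' → ℝ} (hab : aA - aB = ε) (hsA : 0 < sA) (hsB : 0 < sB)
    (hSAm : ∀ n, Measurable (SA n)) (hVAm : ∀ n, Measurable (VA n))
    (hSBm : ∀ n, Measurable (SB n)) (hVBm : ∀ n, Measurable (VB n))
    (hVB0 : ∀ n ω, 0 ≤ VB n ω)
    (hcltA : TendstoInDistribution (fun (n : ℕ) ω => Real.sqrt n * (SA n ω - aA)) atTop ZA
      (fun _ => PA) P') (hZA : HasLaw ZA (gaussianReal 0 sA.toNNReal) P')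
    (hcltB : TendstoInDistribution (fun (n : ℕ) ω => Real.sqrt n * (SB n ω - aB)) atTop ZB
      (fun _ => PB) P') (hZB : HasLaw ZB (gaussianReal 0 sB.toNNReal) P')
    (hVA : TendstoInMeasure PA (fun (n : ℕ) ω => (n : ℝ) * VA n ω) atTop fun _ => sA)
    (hVB : TendstoInMeasure PB (fun (n : ℕ) ω => (n : ℝ) * VB n ω) atTop fun _ => sB)
    {m : ℕ → ℕ} (hm : Tendsto m atTop atTop) (hZ : HasLaw Z (gaussianReal 0 1) P') (z : ℝ)
    {η : ℝ} (hη : 0 < η) :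
    ∀ᶠ n in atTop, (PA.prod PB).real {ω : ΩA × ΩB |
        |SA n ω.1 - SB (m n) ω.2| + z * Real.sqrt (VA n ω.1 + VB (m n) ω.2) ≤ ε}
      < (gaussianReal 0 1).real (Iic (-z)) + η := by
  -- Step 1: recentre code `B` by `ε`; the null theorem gives `T'ₙ = (Dₙ − ε)/σ̂ₙ ⇒ Z`
  set SB' : ℕ → ΩB → ℝ := fun k ω => SB k ω + ε with hSB'
  have hSB'm : ∀ n, Measurable (SB' n) := fun n => (hSBm n).add_const _
  have hcltB' : TendstoInDistribution (fun (n : ℕ) ω => Real.sqrt n * (SB' n ω - aA)) atTop ZB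
      (fun _ => PB) P' := by
    refine hcltB.congr (fun n => Eventually.of_forall fun ω => ?_) EventuallyEq.rfl
    simp only [hSB']
    rw [← hab]
    ring
  have hT := twoSample_agreement_clt_of_tendstoInMeasure hsA hsB hSAm hVAm hSB'm hVBm hcltA hZA
    hcltB' hZB hVA hVB hm hZ
  -- Step 2: `P(T'ₙ ≤ −z) → N(0,1)((−∞, −z])`
  have hfr : (P'.map Z) (frontier (Iic (-z))) = 0 := by
    rw [frontier_Iic, hZ.map_eq]
    haveI := nullSingletonClass_gaussianReal (μ := 0) one_ne_zero
    exact measure_singleton _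
  have hlim := tendsto_measureReal_preimage_of_tendstoInDistribution hT measurableSet_Iic hfr
  have hZev : P'.real (Z ⁻¹' Iic (-z)) = (gaussianReal 0 1).real (Iic (-z)) := by
    rw [measureReal_def, measureReal_def, ← Measure.map_apply_of_aemeasurable hZ.aemeasurable
      measurableSet_Iic, hZ.map_eq]
  rw [hZev] at hlim
  -- Step 3: the degenerate-error-bar event has vanishing probability
  have hNA := (tendstoInMeasure_iff_norm.1 (tendstoInMeasure_comp_fst (PB := PB) hVA)) (sA / 2)
    (by positivity)
  have hNA' := (ENNReal.tendsto_toReal ENNReal.zero_ne_top).comp hNA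
  rw [ENNReal.toReal_zero] at hNA'
  have hsum := hlim.add hNA'
  rw [add_zero] at hsum
  have hev := (tendsto_order.1 hsum).2 _ (lt_add_of_pos_right _ hη)
  filter_upwards [hev, eventually_ge_atTop 1] with n hn hn1
  refine lt_of_le_of_lt ?_ hn
  -- Step 4: pass event ⊆ {T'ₙ ≤ −z} ∪ {s_A/2 ≤ |n V̂ₙ^A − s_A|}
  rw [Function.comp_apply, ← measureReal_def]
  refine (measureReal_mono fun ω hω => ?_).trans (measureReal_union_le _ _)
  simp only [mem_setOf_eq, mem_union, mem_preimage, mem_Iic] at hω ⊢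
  by_contra hnone
  push Not at hnone
  obtain ⟨h1, h2⟩ := hnone
  rw [Real.norm_eq_abs, abs_sub_lt_iff] at h2
  have hn0 : (0 : ℝ) < n := by exact_mod_cast hn1
  have hVApos : 0 < VA n ω.1 := by
    by_contra hle
    have : (n : ℝ) * VA n ω.1 ≤ 0 := mul_nonpos_of_nonneg_of_nonpos hn0.le (not_lt.1 hle)
    linarith [h2.1, h2.2]
  have hV : 0 < VA n ω.1 + VB (m n) ω.2 := add_pos_of_pos_of_nonneg hVApos (hVB0 _ _)
  have hs : 0 < Real.sqrt (VA n ω.1 + VB (m n) ω.2) := Real.sqrt_pos.2 hV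
  have hT' : (SA n ω.1 - SB' (m n) ω.2) / Real.sqrt (VA n ω.1 + VB (m n) ω.2) ≤ -z := by
    rw [div_le_iff₀ hs]
    simp only [hSB']
    have := le_abs_self (SA n ω.1 - SB (m n) ω.2)
    linarith
  exact absurd hT' (not_le.2 h1)

end Tolerance

end Summit.Ventures.LatticeQCDFlow.Scoring.CardConsistency

end
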